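import Summits.QuantumFields.BalabanUV.Beta.FP.CoarseCovarianceInverse
import Summits.QuantumFields.BalabanUV.Beta.GAN24.LatticeKernelConvolution
import Literature.MathematicalPhysics.QuantumFieldTheory.Balaban1983to89.B4Green244

/-!
# `BalabanUV.Beta.FP.CoarseCovarianceInverseKernel` — road «FP» (binder row D1), row H′2-IR ∕ IR-2 (vi): **THE COARSE LATTICE KERNEL OF THE
# INVERSE SYMBOL IS THE TWO-SIDED INVERSE OF THE COARSE COVARIANCE KERNEL** —
# `Σ_λ Σ'_{w ∈ ℤ^D} K[GC_{αλ}](z − w)·K[Ĉ_{n,λβ}](w) = δ_{αβ}·δ_{z,0} = Σ_λ Σ'_w K[Ĉ_{n,αλ}](z − w)·K[GC_{λβ}](w)` (`D = d+1 ≥ 3`, every `n ≥ 1`),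
# where `K[Ĉ_{n,λβ}](u − v) = coarseCovMean n K^{BF} λ β u v` is leaf-02-g7's mass-one coarse covariance of the BF propagator (`coarseCovMean_latticeKernel_BF`)

HONEST FRAMING (cell contract, verbatim): «discharging `BetaPertH` makes Bałaban's UV stability UNCONDITIONAL — a real constructive-QFT
result; it is NOT the continuum limit and NOT the Clay problem.»  HONEST DEPENDENCY (verbatim): «continuum YM on T⁴ ⇐ BetaPertH ∧ nine
spine estimates (0/9 proved); BetaPertH ⇐ (D1) ∧ (D4) ∧ CAP+tail; G-an2-4 gates asym, D1 and NE2/3/4.»  THIS MODULE DISCHARGES NOTHING of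
D1 ∕ BetaPertH: [folklore] Fourier analysis on `ℤ^D` — an `L¹` CONVOLUTION THEOREM generalising gan24-leaf-07's `LatticeKernelConvolution.tsum_latticeKernel_mul`
(one factor strip-regular, the other merely zone-integrable), by the pointwise Fourier series of the strip-regular factor (`hasSum_descend` BY NAME) and
`integral_tsum_of_summable_integral_norm` — instantiated with files (ii)∕(iv)(v) of this row and leaf-02-g7's `integrableOn_integrand_covSym_PbfSym` BY NAME.
No def; no `def … : Prop`; nothing is cited; 0 sorry.  NOT summit progress; NOT BetaPertH, NOT continuum, NOT Clay.

ABSOLUTE RULE (cell, verbatim): «No internally-minted statement may enter as a cited fact. Every hypothesis is either kernel-proved in this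
package or a verbatim quotation of a PUBLISHED theorem with page reference. The manuscript(s) under audit are NOT citable for their own
disputed steps — they are the thing under adjudication; programme-internal (2001/route/tribunal) claims are never citable.»

CONTENT (`D = d+1`).
* §1 [folklore] **`hasSum_latticeKernel_cexp`** (Fourier series of a strip-regular symbol at a real zone point:
  `A(p) = Σ_m K[A](m)·e^{−ip·m}`), `norm_integrand_eq`, **`tsum_latticeKernel_mul_of_integrableOn`** ∕ `summable_latticeKernel_mul_of_stripRegular` (the `L¹` convolution theorem
  `Σ'_w K[A](z − w)·K[C](w) = K[A·C](z)` for `A` strip-regular (`κ > 0`) and `C ∘ ofRealVec ∈ L¹(BZ)`), `tsum_latticeKernel_mul_of_integrableOn'` (roles swapped).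
* §2 [our object] `integrableOn_Chol` (`D ≥ 3`), `integrableOn_GC_mul_Chol`∕`_Chol_mul_GC`, `ae_ne_zero_BZ`, `ae_GC_mul_Chol`∕`ae_Chol_mul_GC`,
  **`kernel_GC_mul_Chol`**, **`kernel_Chol_mul_GC`** (THE TWO-SIDED INVERSE IDENTITIES), the reading `latticeKernel_Chol_eq`∕`latticeKernel_Chol_eq_coarseCovMean`
  against leaf-02-g7's `coarseCovMean`, and **`kernel_GC_mul_coarseCovMean`** ∕ **`kernel_coarseCovMean_mul_GC`** (`G_C·C_n = C_n·G_C = 1` as kernels on `ℤ^D`).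
Unit `b2b-balaban-beta-d1-formalise-leaf-06` (gen 8), owner ruling R-FP-21 (A3)∕(C).
-/

noncomputable section

namespace Summit.QuantumFields.BalabanUV.Beta.FP.CoarseCovarianceInverseKernel

open Finset Complex Set MeasureTheory Matrix
open scoped BigOperators ComplexConjugate Real
open Literature.MathematicalPhysics.QuantumFieldTheory.Balaban1983to89
open B4Strip (Strip ofRealVec)
open B4ContourShift (BZ phase integrand fourierBox latticeKernel StripRegular supNorm latticeKernel_decay norm_cexp_phase)
open B4TorusKernel (descend descendC descend_coe unitBox mFourierCoeff_descend mFourier_coe_eq summable_of_decay)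
open B5Prop11Fiber (d1Sym)
open Summit.QuantumFields.BalabanUV.Beta.GAN24.LatticeKernelConvolution (toT hasSum_descend)
open Summit.QuantumFields.BalabanUV.Beta.FP.PerfectPropagatorSymbol (PinfSym)
open Summit.QuantumFields.BalabanUV.Beta.FP.AliasDecimateIntegrable (integrableOn_integrand_of_integrableOn measurableSet_BZ)
open Summit.QuantumFields.BalabanUV.Beta.FP.CoarseCovarianceAlias (covSym covSymMean coarseCovMean)
open Summit.QuantumFields.BalabanUV.Beta.FP.CoarseCovarianceAliasBF (PbfSym latticeKernel_congr_ae coarseCovMean_latticeKernel_BF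
  integrableOn_integrand_covSym_PbfSym)
open Summit.QuantumFields.BalabanUV.Beta.FP.CoarseCovarianceStrip
open Summit.QuantumFields.BalabanUV.Beta.FP.CoarseCovarianceStripBn
open Summit.QuantumFields.BalabanUV.Beta.FP.CoarseCovarianceInverse

variable {d : ℕ}

/-! ## §1 The `L¹` convolution theorem -/

/-- [folklore] **THE FOURIER SERIES OF A STRIP-REGULAR SYMBOL AT A REAL ZONE POINT**: for `A` strip-regular of half-width `κ > 0` and
`p ∈ [−π,π]^D`, `Σ_m K[A](m)·e^{−i p·m} = A(p)` (absolutely convergent; gan24-leaf-07's `hasSum_descend` + pv07's torus dictionary BY NAME). -/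
theorem hasSum_latticeKernel_cexp {A : (Fin (d + 1) → ℂ) → ℂ} {κ MA : ℝ} (hA : StripRegular A κ MA) (hκ : 0 < κ)
    {p : Fin (d + 1) → ℝ} (hp : p ∈ BZ (d + 1)) :
    HasSum (fun m : Fin (d + 1) → ℤ => latticeKernel A m * cexp (-(I * phase p m))) (A (ofRealVec p)) := by
  have hπ := Real.pi_pos
  set x : Fin (d + 1) → ℝ := fun i => p i / (2 * π) with hxdef
  have hpBZ : ∀ i, -π ≤ p i ∧ p i ≤ π := fun i => by
    have h := hp; unfold BZ at h; rw [Set.mem_Icc] at h; exact ⟨h.1 i, h.2 i⟩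
  have hx : x ∈ unitBox d := by
    refine ⟨fun i => ?_, fun i => ?_⟩
    · show -(1 / 2 : ℝ) ≤ p i / (2 * π)
      rw [le_div_iff₀ (by positivity)]; linarith [(hpBZ i).1]
    · show p i / (2 * π) ≤ 1 / 2
      rw [div_le_iff₀ (by positivity)]; linarith [(hpBZ i).2]
  have hpx : (fun i => 2 * π * x i) = p := funext fun i => by rw [hxdef]; field_simp
  have h := hasSum_descend hA hκ (toT x)
  have hdesc : descend A (toT x) = A (ofRealVec p) := by
    have e := descend_coe hA hκ.le hx
    rw [hpx] at e
    exact e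
  rw [hdesc] at h
  have hterm : ∀ n : Fin (d + 1) → ℤ,
      UnitAddTorus.mFourierCoeff (descendC A hA hκ.le) n * UnitAddTorus.mFourier n (toT x) = latticeKernel A (-n) * cexp (I * phase p n) := by
    intro n
    rw [mFourierCoeff_descend hA hκ.le n]
    congr 1
    have e := mFourier_coe_eq n x
    have hsx : (2 * π) • x = p := by rw [← hpx]; funext i; simp [Pi.smul_apply, smul_eq_mul]
    rw [hsx] at e
    exact e
  simp_rw [hterm] at h
  have h2 := (Equiv.neg (Fin (d + 1) → ℤ)).hasSum_iff.mpr h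
  have phase_neg : ∀ m : Fin (d + 1) → ℤ, phase p (-m) = -phase p m := fun m => by simp [phase, Finset.sum_neg_distrib]
  refine h2.congr_fun fun m => ?_
  simp only [Function.comp_apply, Equiv.neg_apply, neg_neg, phase_neg, mul_neg]

/-- [folklore] the phase-weighted integrand has the modulus of the symbol. -/
theorem norm_integrand_eq (C : (Fin (d + 1) → ℂ) → ℂ) (w : Fin (d + 1) → ℤ) (q : Fin (d + 1) → ℝ) :
    ‖integrand C w q‖ = ‖C (ofRealVec q)‖ := by
  rw [integrand, norm_mul, norm_cexp_phase, mul_one]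

/-- [folklore] the kernel of a strip-regular symbol, shifted, is absolutely summable. -/
theorem summable_norm_latticeKernel_shift {A : (Fin (d + 1) → ℂ) → ℂ} {κ MA : ℝ} (hA : StripRegular A κ MA) (hκ : 0 < κ)
    (z : Fin (d + 1) → ℤ) : Summable fun w : Fin (d + 1) → ℤ => ‖latticeKernel A (z - w)‖ := by
  have hs : Summable fun m : Fin (d + 1) → ℤ => ‖latticeKernel A m‖ :=
    (summable_of_decay _ hκ (fun m => latticeKernel_decay hA hκ.le m)).norm
  exact (Equiv.subLeft z).summable_iff.mpr hs

/-- [folklore] **THE `L¹` CONVOLUTION THEOREM**: for `A` strip-regular (half-width `κ > 0`) and `C` with `C ∘ ofRealVec` integrable on the zone,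
`Σ'_{w ∈ ℤ^D} K[A](z − w)·K[C](w) = K[A·C](z)` — with absolute convergence (`summable_latticeKernel_mul_of_stripRegular`). -/
theorem tsum_latticeKernel_mul_of_integrableOn {A C : (Fin (d + 1) → ℂ) → ℂ} {κ MA : ℝ} (hA : StripRegular A κ MA) (hκ : 0 < κ)
    (hC : IntegrableOn (fun p => C (ofRealVec p)) (BZ (d + 1))) (z : Fin (d + 1) → ℤ) :
    ∑' w, latticeKernel A (z - w) * latticeKernel C w = latticeKernel (fun p => A p * C p) z := by
  -- the terms `F w q = K[A](z − w)·C(q)e^{iq·w}` on the zone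
  set F : (Fin (d + 1) → ℤ) → (Fin (d + 1) → ℝ) → ℂ := fun w q => latticeKernel A (z - w) * integrand C w q with hF
  have hFi : ∀ w, Integrable (F w) (volume.restrict (BZ (d + 1))) := fun w =>
    (integrableOn_integrand_of_integrableOn hC w).const_mul _
  have hFn : ∀ w, ∫ q in BZ (d + 1), ‖F w q‖ = ‖latticeKernel A (z - w)‖ * ∫ q in BZ (d + 1), ‖C (ofRealVec q)‖ := by
    intro w
    simp only [hF, norm_mul, norm_integrand_eq]
    rw [integral_const_mul]
  have hFs : Summable fun w => ∫ q in BZ (d + 1), ‖F w q‖ := by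
    simp_rw [hFn]
    exact (summable_norm_latticeKernel_shift hA hκ z).mul_right _
  -- exchange
  have hex : ∑' w, ∫ q in BZ (d + 1), F w q = ∫ q in BZ (d + 1), ∑' w, F w q := integral_tsum_of_summable_integral_norm hFi hFs
  -- each cell integral
  have hint : ∀ w, ∫ q in BZ (d + 1), F w q = latticeKernel A (z - w) * fourierBox C w := fun w => by
    simp only [hF]; rw [integral_const_mul]; rfl
  -- the pointwise sum on the zone
  have hpt : ∀ q ∈ BZ (d + 1), ∑' w, F w q = integrand (fun p => A p * C p) z q := by
    intro q hq
    have hser := hasSum_latticeKernel_cexp hA hκ hq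
    simp only [hF, integrand]
    have phase_sub : ∀ x y : Fin (d + 1) → ℤ, phase q (x - y) = phase q x - phase q y := fun x y => by
      simp [phase, ← Finset.sum_sub_distrib, mul_sub]
    have e0 : ∀ w, cexp (-(I * phase q (z - w))) = cexp (-(I * phase q z)) * cexp (I * phase q w) := fun w => by
      rw [← Complex.exp_add, phase_sub]
      congr 1
      ring
    have e1 : ∀ w, latticeKernel A (z - w) * (C (ofRealVec q) * cexp (I * phase q w))
        = C (ofRealVec q) * cexp (I * phase q z) * (latticeKernel A (z - w) * cexp (-(I * phase q (z - w)))) := by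
      intro w
      rw [e0, Complex.exp_neg]
      have hz : cexp (I * phase q z) ≠ 0 := Complex.exp_ne_zero _
      field_simp
    simp_rw [e1]
    rw [tsum_mul_left]
    have e2 : ∑' w, latticeKernel A (z - w) * cexp (-(I * phase q (z - w))) = ∑' m, latticeKernel A m * cexp (-(I * phase q m)) :=
      (Equiv.subLeft z).tsum_eq (fun m => latticeKernel A m * cexp (-(I * phase q m)))
    rw [e2, hser.tsum_eq]
    ring
  -- assemble
  calc ∑' w, latticeKernel A (z - w) * latticeKernel C w
      = ∑' w, ((((2 * π) ^ (d + 1))⁻¹ : ℝ) : ℂ) * ∫ q in BZ (d + 1), F w q := by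
        refine tsum_congr fun w => ?_
        have hKC : latticeKernel C w = ((((2 * π) ^ (d + 1))⁻¹ : ℝ) : ℂ) * fourierBox C w := by rw [latticeKernel, Complex.real_smul]
        rw [hint w, hKC]; ring
    _ = ((((2 * π) ^ (d + 1))⁻¹ : ℝ) : ℂ) * ∫ q in BZ (d + 1), ∑' w, F w q := by rw [tsum_mul_left, hex]
    _ = latticeKernel (fun p => A p * C p) z := by
        rw [latticeKernel, Complex.real_smul, fourierBox, setIntegral_congr_fun measurableSet_BZ hpt]

/-- [folklore] absolute convergence of the convolution of a strip-regular kernel with ANY lattice kernel (the latter is bounded by the zone `L¹` norm). -/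
theorem summable_latticeKernel_mul_of_stripRegular {A C : (Fin (d + 1) → ℂ) → ℂ} {κ MA : ℝ} (hA : StripRegular A κ MA) (hκ : 0 < κ)
    (z : Fin (d + 1) → ℤ) :
    Summable fun w => latticeKernel A (z - w) * latticeKernel C w := by
  have hbd : ∀ w, ‖latticeKernel C w‖ ≤ |((2 * π) ^ (d + 1))⁻¹| * ∫ q in BZ (d + 1), ‖C (ofRealVec q)‖ := fun w => by
    rw [latticeKernel, norm_smul, Real.norm_eq_abs, fourierBox]
    refine mul_le_mul_of_nonneg_left ?_ (abs_nonneg _)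
    refine (norm_integral_le_integral_norm _).trans (le_of_eq ?_)
    exact integral_congr_ae (Filter.Eventually.of_forall fun q => norm_integrand_eq C w q)
  refine Summable.of_norm_bounded ((summable_norm_latticeKernel_shift hA hκ z).mul_right
    (|((2 * π) ^ (d + 1))⁻¹| * ∫ q in BZ (d + 1), ‖C (ofRealVec q)‖)) fun w => ?_
  rw [norm_mul]
  exact mul_le_mul_of_nonneg_left (hbd w) (norm_nonneg _)

/-- [folklore] the `L¹` convolution theorem with the roles swapped: `Σ'_w K[C](z − w)·K[A](w) = K[C·A](z)`. -/
theorem tsum_latticeKernel_mul_of_integrableOn' {A C : (Fin (d + 1) → ℂ) → ℂ} {κ MA : ℝ} (hA : StripRegular A κ MA) (hκ : 0 < κ)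
    (hC : IntegrableOn (fun p => C (ofRealVec p)) (BZ (d + 1))) (z : Fin (d + 1) → ℤ) :
    ∑' w, latticeKernel C (z - w) * latticeKernel A w = latticeKernel (fun p => C p * A p) z := by
  have h := tsum_latticeKernel_mul_of_integrableOn hA hκ hC z
  rw [← (Equiv.subLeft z).tsum_eq] at h
  have e : (fun p : Fin (d + 1) → ℂ => C p * A p) = fun p => A p * C p := funext fun p => mul_comm _ _
  rw [e, ← h]
  refine tsum_congr fun w => ?_
  simp only [Equiv.subLeft_apply, sub_sub_cancel]
  ring

/-! ## §2 The two-sided inverse identities for the coarse covariance of the BF propagator -/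

/-- [our object] the entries of the symbol of record are zone-integrable (`D ≥ 3`; leaf-02-g7's `integrableOn_integrand_covSym_PbfSym` BY NAME). -/
theorem integrableOn_Chol (hd : 3 ≤ d + 1) (n : ℕ) [NeZero n] (lam β : Fin (d + 1)) :
    IntegrableOn (fun q : Fin (d + 1) → ℝ => Chol n (ofRealVec q) lam β) (BZ (d + 1)) := by
  have h := (integrableOn_integrand_covSym_PbfSym hd n lam β 0).const_mul ((((n : ℂ) ^ (d + 2))⁻¹) ^ 2)
  refine h.congr (Filter.Eventually.of_forall fun q => ?_)
  have h0 : phase q (0 : Fin (d + 1) → ℤ) = 0 := by simp [phase]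
  show (((n : ℂ) ^ (d + 2))⁻¹) ^ 2 * integrand (covSym n lam β (PbfSym lam β)) 0 q = Chol n (ofRealVec q) lam β
  rw [Chol_ofRealVec, integrand, h0, mul_zero, Complex.exp_zero, mul_one]
  rfl

/-- [folklore] `k ↦ GC n k α λ` read on the real zone is continuous. -/
theorem continuousOn_GC_ofRealVec (n : ℕ) [NeZero n] (α lam : Fin (d + 1)) :
    ContinuousOn (fun q : Fin (d + 1) → ℝ => GC n (ofRealVec q) α lam) (BZ (d + 1)) :=
  (stripRegular_GC n α lam).cont.comp B4ContourShift.continuous_ofRealVec.continuousOn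
    fun _ hq => B4ContourShift.ofRealVec_mem_Strip (kapC_pos d).le hq

/-- [our object] the products `GC_{αλ}·Ĉ_{n,λβ}` are zone-integrable (continuous × integrable on the compact zone). -/
theorem integrableOn_GC_mul_Chol (hd : 3 ≤ d + 1) (n : ℕ) [NeZero n] (α lam β : Fin (d + 1)) :
    IntegrableOn (fun q : Fin (d + 1) → ℝ => GC n (ofRealVec q) α lam * Chol n (ofRealVec q) lam β) (BZ (d + 1)) :=
  IntegrableOn.continuousOn_mul (continuousOn_GC_ofRealVec n α lam) (integrableOn_Chol hd n lam β) isCompact_Icc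

/-- [our object] the products `Ĉ_{n,αλ}·GC_{λβ}` are zone-integrable. -/
theorem integrableOn_Chol_mul_GC (hd : 3 ≤ d + 1) (n : ℕ) [NeZero n] (α lam β : Fin (d + 1)) :
    IntegrableOn (fun q : Fin (d + 1) → ℝ => Chol n (ofRealVec q) α lam * GC n (ofRealVec q) lam β) (BZ (d + 1)) :=
  IntegrableOn.mul_continuousOn (integrableOn_Chol hd n α lam) (continuousOn_GC_ofRealVec n lam β) isCompact_Icc

/-- [folklore] almost every zone point is non-zero. -/
theorem ae_ne_zero_BZ : ∀ᵐ p ∂(volume.restrict (BZ (d + 1))), p ≠ (0 : Fin (d + 1) → ℝ) := by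
  refine ae_restrict_of_ae ?_
  have h : ({(0 : Fin (d + 1) → ℝ)} : Set (Fin (d + 1) → ℝ))ᶜ ∈ ae (volume : Measure (Fin (d + 1) → ℝ)) :=
    compl_mem_ae_iff.mpr (measure_singleton _)
  filter_upwards [h] with p hp
  simpa using hp

/-- [our object] at almost every real zone point `Σ_λ GC_{αλ}·Ĉ_{n,λβ} = δ_{αβ}` (file (iv)(v) `GC_mul_Chol_real` off the null point `0`). -/
theorem ae_GC_mul_Chol (n : ℕ) [NeZero n] (α β : Fin (d + 1)) :
    ∀ᵐ p ∂(volume.restrict (BZ (d + 1))),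
      ∑ lam, GC n (ofRealVec p) α lam * Chol n (ofRealVec p) lam β = if α = β then (1 : ℂ) else 0 := by
  filter_upwards [ae_ne_zero_BZ, ae_restrict_mem measurableSet_BZ] with p hp hpBZ
  have h := congrFun (congrFun (GC_mul_Chol_real n hpBZ hp) α) β
  rw [Matrix.mul_apply] at h
  simp only [h, Matrix.one_apply]

/-- [our object] likewise `Σ_λ Ĉ_{n,αλ}·GC_{λβ} = δ_{αβ}` almost everywhere. -/
theorem ae_Chol_mul_GC (n : ℕ) [NeZero n] (α β : Fin (d + 1)) :
    ∀ᵐ p ∂(volume.restrict (BZ (d + 1))),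
      ∑ lam, Chol n (ofRealVec p) α lam * GC n (ofRealVec p) lam β = if α = β then (1 : ℂ) else 0 := by
  filter_upwards [ae_ne_zero_BZ, ae_restrict_mem measurableSet_BZ] with p hp hpBZ
  have h := congrFun (congrFun (Chol_mul_GC_real n hpBZ hp) α) β
  rw [Matrix.mul_apply] at h
  simp only [h, Matrix.one_apply]

/-- [our object] **THE LEFT INVERSE IDENTITY**: `Σ_λ Σ'_w K[GC_{αλ}](z − w)·K[Ĉ_{n,λβ}](w) = δ_{αβ}·δ_{z,0}` (`D ≥ 3`, every `n ≥ 1`). -/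
theorem kernel_GC_mul_Chol (hd : 3 ≤ d + 1) (n : ℕ) [NeZero n] (α β : Fin (d + 1)) (z : Fin (d + 1) → ℤ) :
    ∑ lam, ∑' w, latticeKernel (fun k => GC n k α lam) (z - w) * latticeKernel (fun k => Chol n k lam β) w
      = if z = 0 then (if α = β then 1 else 0) else 0 := by
  have hconv : ∀ lam, ∑' w, latticeKernel (fun k => GC n k α lam) (z - w) * latticeKernel (fun k => Chol n k lam β) w
      = latticeKernel (fun k => GC n k α lam * Chol n k lam β) z := fun lam =>
    tsum_latticeKernel_mul_of_integrableOn (stripRegular_GC n α lam) (kapC_pos d) (integrableOn_Chol hd n lam β) z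
  simp_rw [hconv]
  have hsum : ∑ lam, latticeKernel (fun k => GC n k α lam * Chol n k lam β) z = latticeKernel (fun k => ∑ lam, GC n k α lam * Chol n k lam β) z := by
    have h := B4Green244.latticeKernel_sum_mul Finset.univ (fun _ => (1 : ℂ)) (fun lam k => GC n k α lam * Chol n k lam β) z
      (fun lam _ => integrableOn_integrand_of_integrableOn (integrableOn_GC_mul_Chol hd n α lam β) z)
    simp only [one_mul] at h
    exact h.symm
  rw [hsum, latticeKernel_congr_ae (G₁ := fun k => ∑ lam, GC n k α lam * Chol n k lam β) (G₂ := fun _ => if α = β then (1 : ℂ) else 0)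
    (ae_GC_mul_Chol n α β) z]
  by_cases hab : α = β
  · simp only [hab, if_true]
    exact B4Green244.latticeKernel_one z
  · simp only [hab, if_false, ite_self]
    simp [latticeKernel, fourierBox, integrand]

/-- [our object] **THE RIGHT INVERSE IDENTITY**: `Σ_λ Σ'_w K[Ĉ_{n,αλ}](z − w)·K[GC_{λβ}](w) = δ_{αβ}·δ_{z,0}` (`D ≥ 3`, every `n ≥ 1`). -/
theorem kernel_Chol_mul_GC (hd : 3 ≤ d + 1) (n : ℕ) [NeZero n] (α β : Fin (d + 1)) (z : Fin (d + 1) → ℤ) :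
    ∑ lam, ∑' w, latticeKernel (fun k => Chol n k α lam) (z - w) * latticeKernel (fun k => GC n k lam β) w
      = if z = 0 then (if α = β then 1 else 0) else 0 := by
  have hconv : ∀ lam, ∑' w, latticeKernel (fun k => Chol n k α lam) (z - w) * latticeKernel (fun k => GC n k lam β) w
      = latticeKernel (fun k => Chol n k α lam * GC n k lam β) z := fun lam =>
    tsum_latticeKernel_mul_of_integrableOn' (stripRegular_GC n lam β) (kapC_pos d) (integrableOn_Chol hd n α lam) z
  simp_rw [hconv]
  have hsum : ∑ lam, latticeKernel (fun k => Chol n k α lam * GC n k lam β) z = latticeKernel (fun k => ∑ lam, Chol n k α lam * GC n k lam β) z := by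
    have h := B4Green244.latticeKernel_sum_mul Finset.univ (fun _ => (1 : ℂ)) (fun lam k => Chol n k α lam * GC n k lam β) z
      (fun lam _ => integrableOn_integrand_of_integrableOn (integrableOn_Chol_mul_GC hd n α lam β) z)
    simp only [one_mul] at h
    exact h.symm
  rw [hsum, latticeKernel_congr_ae (G₁ := fun k => ∑ lam, Chol n k α lam * GC n k lam β) (G₂ := fun _ => if α = β then (1 : ℂ) else 0)
    (ae_Chol_mul_GC n α β) z]
  by_cases hab : α = β
  · simp only [hab, if_true]
    exact B4Green244.latticeKernel_one z
  · simp only [hab, if_false, ite_self]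
    simp [latticeKernel, fourierBox, integrand]

/-- [our object] the coarse lattice kernel of `Chol` is that of leaf-02-g7's literal `covSymMean n λ β (PbfSym λ β)` (they agree at every real point). -/
theorem latticeKernel_Chol_eq (n : ℕ) [NeZero n] (lam β : Fin (d + 1)) (w : Fin (d + 1) → ℤ) :
    latticeKernel (fun k => Chol n k lam β) w = latticeKernel (covSymMean n lam β (PbfSym lam β)) w :=
  B4Green244.latticeKernel_congr (fun p _ => Chol_ofRealVec n p lam β) w

/-- [our object] **THE READING AGAINST LEAF-02-g7's COARSE COVARIANCE**: under the hypotheses of `coarseCovMean_latticeKernel_BF` (the fine bond kernel `K`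
is the lattice kernel of an extension `G₀` of the BF propagator symbol), `K[Ĉ_{n,λβ}](u − v) = coarseCovMean n K λ β u v`. -/
theorem latticeKernel_Chol_eq_coarseCovMean (hd : 3 ≤ d + 1) (n : ℕ) [NeZero n]
    {K : Fin (d + 1) → Fin (d + 1) → (Fin (d + 1) → ℤ) → ℂ} {G₀ : Fin (d + 1) → Fin (d + 1) → (Fin (d + 1) → ℂ) → ℂ}
    (hG₀ : ∀ κ l, ∀ s ∈ BZ (d + 1), G₀ κ l (ofRealVec s) = PinfSym s (d1Sym s) κ l) (hK : ∀ κ l x, K κ l x = latticeKernel (G₀ κ l) x)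
    (lam β : Fin (d + 1)) (u v : Fin (d + 1) → ℤ) :
    latticeKernel (fun k => Chol n k lam β) (u - v) = coarseCovMean n K lam β u v := by
  rw [latticeKernel_Chol_eq, coarseCovMean_latticeKernel_BF hd n (hG₀ lam β) (hK lam β) u v]

/-- [our object] **`G_C·C_n = 1` AT THE KERNEL LEVEL**: `Σ_λ Σ'_w K[GC_{αλ}](u − w)·coarseCovMean n K λ β w v = δ_{αβ}·δ_{u,v}` — the coarse lattice kernel
of the inverse symbol IS the inverse of the mass-one coarse covariance of the BF propagator (`D ≥ 3`, every `n ≥ 1`). -/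
theorem kernel_GC_mul_coarseCovMean (hd : 3 ≤ d + 1) (n : ℕ) [NeZero n]
    {K : Fin (d + 1) → Fin (d + 1) → (Fin (d + 1) → ℤ) → ℂ} {G₀ : Fin (d + 1) → Fin (d + 1) → (Fin (d + 1) → ℂ) → ℂ}
    (hG₀ : ∀ κ l, ∀ s ∈ BZ (d + 1), G₀ κ l (ofRealVec s) = PinfSym s (d1Sym s) κ l) (hK : ∀ κ l x, K κ l x = latticeKernel (G₀ κ l) x)
    (α β : Fin (d + 1)) (u v : Fin (d + 1) → ℤ) :
    ∑ lam, ∑' w, latticeKernel (fun k => GC n k α lam) (u - w) * coarseCovMean n K lam β w v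
      = if u = v then (if α = β then 1 else 0) else 0 := by
  have h := kernel_GC_mul_Chol hd n α β (u - v)
  simp only [sub_eq_zero] at h
  rw [← h]
  refine Finset.sum_congr rfl fun lam _ => ?_
  rw [← (Equiv.subRight v).tsum_eq (fun w => latticeKernel (fun k => GC n k α lam) (u - v - w) * latticeKernel (fun k => Chol n k lam β) w)]
  refine tsum_congr fun w => ?_
  rw [Equiv.subRight_apply, sub_sub_sub_cancel_right, latticeKernel_Chol_eq_coarseCovMean hd n hG₀ hK]

/-- [our object] **`C_n·G_C = 1` AT THE KERNEL LEVEL**: `Σ_λ Σ'_w coarseCovMean n K α λ u w·K[GC_{λβ}](w − v) = δ_{αβ}·δ_{u,v}`. -/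
theorem kernel_coarseCovMean_mul_GC (hd : 3 ≤ d + 1) (n : ℕ) [NeZero n]
    {K : Fin (d + 1) → Fin (d + 1) → (Fin (d + 1) → ℤ) → ℂ} {G₀ : Fin (d + 1) → Fin (d + 1) → (Fin (d + 1) → ℂ) → ℂ}
    (hG₀ : ∀ κ l, ∀ s ∈ BZ (d + 1), G₀ κ l (ofRealVec s) = PinfSym s (d1Sym s) κ l) (hK : ∀ κ l x, K κ l x = latticeKernel (G₀ κ l) x)
    (α β : Fin (d + 1)) (u v : Fin (d + 1) → ℤ) :
    ∑ lam, ∑' w, coarseCovMean n K α lam u w * latticeKernel (fun k => GC n k lam β) (w - v)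
      = if u = v then (if α = β then 1 else 0) else 0 := by
  have h := kernel_Chol_mul_GC hd n α β (u - v)
  simp only [sub_eq_zero] at h
  rw [← h]
  refine Finset.sum_congr rfl fun lam _ => ?_
  rw [← (Equiv.subRight v).tsum_eq (fun w => latticeKernel (fun k => Chol n k α lam) (u - v - w) * latticeKernel (fun k => GC n k lam β) w)]
  refine tsum_congr fun w => ?_
  rw [Equiv.subRight_apply, sub_sub_sub_cancel_right, latticeKernel_Chol_eq_coarseCovMean hd n hG₀ hK]

end Summit.QuantumFields.BalabanUV.Beta.FP.CoarseCovarianceInverseKernel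

end
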